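import Summits.SmoothPoincare4.SmoothPoincare4.Theorems.SymplecticOrigamiGromovRecognitionRelEndStubFlatCutoffAux
import Literature.Geometry.Manifold.InverseFunctionTheorem

/-!
# Tame cut-off of the bi-foliation chart — decay in both factors, small perturbations of the
# identity, radial cut-offs
(stub `stub_flatCutoff` of line `cross-cap-laurent`, crux `GromovRecognitionRelEnd`, item
stmt-SmoothPoincare4-11009; third of four files)

* `decay_of_smooth_at_wedge`: the two-factor form of the `C¹`-decay at infinity (the second
  factor is reduced to the first by conjugating with the factor swap; `max(|z₁|, |z₂|) ≥ ‖w‖/√2`),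
  with exactly the hypotheses (B3a), (B3b), (B4), (B5) of the registered stub and the one-factor
  estimate (`decay_first_factor` of the second file) as a hypothesis, so that the second and third
  files elaborate independently of each other;
* `exists_diffeomorph_of_norm_fderiv_sub_id_le` (registered helper sub-goal
  `helper_flatCutoffPerturbId` is its `ℝ⁴` case): a `C^n` map `F` of a Banach space with
  `‖DF - I‖ ≤ ½` everywhere is a `C^n` diffeomorphism (mean value inequality, Banach fixed point,
  Neumann series, the tree's inverse function theorem `isLocalDiffeomorphAt_of_mfderiv`, and
  Mathlib's `IsLocalDiffeomorph.diffeomorphOfBijective`);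
* `exists_radial_cutoff`: smooth radial cut-offs `θ_ρ : ℝ⁴ → [0, 1]`, `= 0` on `‖y‖ ≤ ρ`, `= 1` on
  `‖y‖ ≥ 2ρ`, with `‖Dθ_ρ‖ ≤ 4c/ρ` for one constant `c` (from `Real.smoothTransition`).

Everything is proved; no definition, no named fact.

References: J. M. Lee, *Introduction to Smooth Manifolds*, 2nd ed. (2013), Thm. 4.5
[LeeSmoothManifolds2013].
-/

noncomputable section

-- the registered namespace `Summit.SmoothPoincare4.SmoothPoincare4.Theorems…` repeats a component
set_option linter.dupNamespace false

open scoped Manifold ContDiff Topology NNReal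
open Set Filter Metric
open Literature.Geometry.Symplectic.LegendrianDarboux (euclidean_four_ext)

namespace Summit.SmoothPoincare4.SmoothPoincare4.Theorems.GromovRecognitionRelEnd.CrossCapLaurent

namespace FlatCutoff

/-- Model space `ℝ⁴ = ℂ²` (coordinates `0,1` = `z₁`, `2,3` = `z₂`). -/
local notation "E4" => EuclideanSpace ℝ (Fin 4)
/-- `ℝ² = ℂ`, the coordinate plane of one factor. -/
local notation "E2" => EuclideanSpace ℝ (Fin 2)

/-! ## Both factors: `C¹`-decay at infinity -/

/-- **`C¹`-decay at infinity from smoothness at the wedge** (both factors). Let `G : ℝ⁴ → ℝ⁴`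
fix `z₁` on `{|z₁| > R₁}` and `z₂` on `{|z₂| > R₁}`, and suppose that the `z₂`-component of `G` in
the chart `u = 1/z₁` and the `z₁`-component of `G` in the chart `t = 1/z₂` extend `C¹` across the
respective axes by the identity (hypotheses (B3)–(B5) of the bi-foliation chart `σ ∘ χ` of line
`cross-cap-laurent`). Then for every `ε > 0` there is `r > 0` such that `G` is differentiable at
every `w` with `‖w‖ ≥ r`, with `‖G w - w‖ ≤ ε` and `‖DG(w) - I‖ ≤ ε`. (The second factor is
reduced to the first by conjugating with the factor swap; `max(|z₁|, |z₂|) ≥ ‖w‖/√2`.) The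
one-factor estimate `decay_first_factor` enters as the hypothesis `hfirst` (so that this file does
not depend on the file proving it). [folklore] -/
theorem decay_of_smooth_at_wedge {R₁ : ℝ}
    (hfirst : ∀ (G' : E4 → E4) (g' : E4 → E2),
      ContDiffOn ℝ 1 g' {p : E4 | p 0 ^ 2 + p 1 ^ 2 < R₁⁻¹ ^ 2} →
      (∀ p q : E4, p 0 ^ 2 + p 1 ^ 2 < R₁⁻¹ ^ 2 → (p 0 ≠ 0 ∨ p 1 ≠ 0) →
        q = G' (WithLp.toLp 2
          ![p 0 / (p 0 ^ 2 + p 1 ^ 2), -(p 1) / (p 0 ^ 2 + p 1 ^ 2), p 2, p 3]) →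
        g' p = WithLp.toLp 2 ![q 2, q 3]) →
      (∀ p : E4, p 0 = 0 → p 1 = 0 → g' p = WithLp.toLp 2 ![p 2, p 3]) →
      (∀ w : E4, R₁ ^ 2 < w 0 ^ 2 + w 1 ^ 2 → (G' w) 0 = w 0 ∧ (G' w) 1 = w 1) →
      (∀ w : E4, R₁ ^ 2 < w 2 ^ 2 + w 3 ^ 2 → (G' w) 2 = w 2 ∧ (G' w) 3 = w 3) →
      ∀ ε : ℝ, 0 < ε → ∃ ρ : ℝ, 0 < ρ ∧ ∀ w : E4, ρ ^ 2 ≤ w 0 ^ 2 + w 1 ^ 2 →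
        DifferentiableAt ℝ G' w ∧ ‖G' w - w‖ ≤ ε ∧
          ‖fderiv ℝ G' w - ContinuousLinearMap.id ℝ E4‖ ≤ ε)
    {G : E4 → E4} {g h : E4 → E2}
    (hg : ContDiffOn ℝ 1 g {p : E4 | p 0 ^ 2 + p 1 ^ 2 < R₁⁻¹ ^ 2})
    (hgG : ∀ p q : E4, p 0 ^ 2 + p 1 ^ 2 < R₁⁻¹ ^ 2 → (p 0 ≠ 0 ∨ p 1 ≠ 0) →
      q = G (WithLp.toLp 2
        ![p 0 / (p 0 ^ 2 + p 1 ^ 2), -(p 1) / (p 0 ^ 2 + p 1 ^ 2), p 2, p 3]) →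
      g p = WithLp.toLp 2 ![q 2, q 3])
    (hg0 : ∀ p : E4, p 0 = 0 → p 1 = 0 → g p = WithLp.toLp 2 ![p 2, p 3])
    (hh : ContDiffOn ℝ 1 h {p : E4 | p 2 ^ 2 + p 3 ^ 2 < R₁⁻¹ ^ 2})
    (hhG : ∀ p q : E4, p 2 ^ 2 + p 3 ^ 2 < R₁⁻¹ ^ 2 → (p 2 ≠ 0 ∨ p 3 ≠ 0) →
      q = G (WithLp.toLp 2
        ![p 0, p 1, p 2 / (p 2 ^ 2 + p 3 ^ 2), -(p 3) / (p 2 ^ 2 + p 3 ^ 2)]) →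
      h p = WithLp.toLp 2 ![q 0, q 1])
    (hh0 : ∀ p : E4, p 2 = 0 → p 3 = 0 → h p = WithLp.toLp 2 ![p 0, p 1])
    (hGa : ∀ w : E4, R₁ ^ 2 < w 0 ^ 2 + w 1 ^ 2 → (G w) 0 = w 0 ∧ (G w) 1 = w 1)
    (hGb : ∀ w : E4, R₁ ^ 2 < w 2 ^ 2 + w 3 ^ 2 → (G w) 2 = w 2 ∧ (G w) 3 = w 3) :
    ∀ ε : ℝ, 0 < ε → ∃ r : ℝ, 0 < r ∧ ∀ w : E4, r ≤ ‖w‖ →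
      DifferentiableAt ℝ G w ∧ ‖G w - w‖ ≤ ε ∧
        ‖fderiv ℝ G w - ContinuousLinearMap.id ℝ E4‖ ≤ ε := by
  intro ε hε
  obtain ⟨ρ₁, hρ₁, h₁⟩ := hfirst G g hg hgG hg0 hGa hGb ε hε
  obtain ⟨P, hP, hPP, hPn, hPle⟩ := exists_clm_swap
  have hPv : ∀ w : E4, (P w) 0 = w 2 ∧ (P w) 1 = w 3 ∧ (P w) 2 = w 0 ∧ (P w) 3 = w 1 :=
    fun w => by simp [hP]
  -- the conjugated data `G' = P ∘ G ∘ P`, `g' = h ∘ P`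
  set G' : E4 → E4 := fun w => P (G (P w)) with hG'
  set g' : E4 → E2 := fun p => h (P p) with hg'
  have hg'c : ContDiffOn ℝ 1 g' {p : E4 | p 0 ^ 2 + p 1 ^ 2 < R₁⁻¹ ^ 2} := by
    refine hh.comp P.contDiff.contDiffOn fun p hp => ?_
    show (P p) 2 ^ 2 + (P p) 3 ^ 2 < R₁⁻¹ ^ 2
    rw [(hPv p).2.2.1, (hPv p).2.2.2]
    exact hp
  have hg'G : ∀ p q : E4, p 0 ^ 2 + p 1 ^ 2 < R₁⁻¹ ^ 2 → (p 0 ≠ 0 ∨ p 1 ≠ 0) →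
      q = G' (WithLp.toLp 2
        ![p 0 / (p 0 ^ 2 + p 1 ^ 2), -(p 1) / (p 0 ^ 2 + p 1 ^ 2), p 2, p 3]) →
      g' p = WithLp.toLp 2 ![q 2, q 3] := by
    intro p q hp hor hq
    have hPT : P (WithLp.toLp 2
        ![p 0 / (p 0 ^ 2 + p 1 ^ 2), -(p 1) / (p 0 ^ 2 + p 1 ^ 2), p 2, p 3]) =
        WithLp.toLp 2 ![(P p) 0, (P p) 1, (P p) 2 / ((P p) 2 ^ 2 + (P p) 3 ^ 2),
          -((P p) 3) / ((P p) 2 ^ 2 + (P p) 3 ^ 2)] := by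
      rw [hP]
      refine euclidean_four_ext ?_ ?_ ?_ ?_ <;> simp [hPv]
    have h1 := hhG (P p) _ (by rw [(hPv p).2.2.1, (hPv p).2.2.2]; exact hp)
      (by rw [(hPv p).2.2.1, (hPv p).2.2.2]; exact hor) rfl
    rw [← hPT] at h1
    show h (P p) = _
    rw [h1, hq, hG']
    ext i
    fin_cases i <;> simp [hPv]
  have hg'0 : ∀ p : E4, p 0 = 0 → p 1 = 0 → g' p = WithLp.toLp 2 ![p 2, p 3] := by
    intro p h0 h1
    show h (P p) = _
    rw [hh0 (P p) (by rw [(hPv p).2.2.1]; exact h0) (by rw [(hPv p).2.2.2]; exact h1)]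
    ext i
    fin_cases i <;> simp [hPv]
  have hG'a : ∀ w : E4, R₁ ^ 2 < w 0 ^ 2 + w 1 ^ 2 → (G' w) 0 = w 0 ∧ (G' w) 1 = w 1 := by
    intro w hw
    have h1 := hGb (P w) (by rw [(hPv w).2.2.1, (hPv w).2.2.2]; exact hw)
    refine ⟨?_, ?_⟩
    · show (P (G (P w))) 0 = w 0
      rw [(hPv _).1, h1.1, (hPv w).2.2.1]
    · show (P (G (P w))) 1 = w 1
      rw [(hPv _).2.1, h1.2, (hPv w).2.2.2]
  have hG'b : ∀ w : E4, R₁ ^ 2 < w 2 ^ 2 + w 3 ^ 2 → (G' w) 2 = w 2 ∧ (G' w) 3 = w 3 := by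
    intro w hw
    have h1 := hGa (P w) (by rw [(hPv w).1, (hPv w).2.1]; exact hw)
    refine ⟨?_, ?_⟩
    · show (P (G (P w))) 2 = w 2
      rw [(hPv _).2.2.1, h1.1, (hPv w).1]
    · show (P (G (P w))) 3 = w 3
      rw [(hPv _).2.2.2, h1.2, (hPv w).2.1]
  obtain ⟨ρ₂, hρ₂, h₂⟩ := hfirst G' g' hg'c hg'G hg'0 hG'a hG'b ε hε
  -- the radius: beyond `√2 · max ρ₁ ρ₂` one of `|z₁|`, `|z₂|` exceeds `max ρ₁ ρ₂`
  set m : ℝ := max ρ₁ ρ₂ with hm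
  have hm0 : 0 < m := hρ₁.trans_le (le_max_left _ _)
  refine ⟨Real.sqrt 2 * m, by positivity, fun w hw => ?_⟩
  have hw2 : 2 * m ^ 2 ≤ w 0 ^ 2 + w 1 ^ 2 + (w 2 ^ 2 + w 3 ^ 2) := by
    have h1 := pow_le_pow_left₀ (by positivity) hw 2
    rw [mul_pow, Real.sq_sqrt (by norm_num), EuclideanSpace.real_norm_sq_eq,
      Fin.sum_univ_four] at h1
    linarith
  by_cases hc : m ^ 2 ≤ w 0 ^ 2 + w 1 ^ 2
  · exact h₁ w ((pow_le_pow_left₀ hρ₁.le (le_max_left _ _) 2).trans hc)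
  · have hc' : m ^ 2 ≤ w 2 ^ 2 + w 3 ^ 2 := by linarith [not_le.1 hc]
    have hc2 : ρ₂ ^ 2 ≤ (P w) 0 ^ 2 + (P w) 1 ^ 2 := by
      rw [(hPv w).1, (hPv w).2.1]
      exact (pow_le_pow_left₀ hρ₂.le (le_max_right _ _) 2).trans hc'
    obtain ⟨hd, h0, hD⟩ := h₂ (P w) hc2
    -- transfer back along the conjugation `G = P ∘ G' ∘ P`
    have hGG' : G = ⇑P ∘ G' ∘ ⇑P := by
      funext v
      simp [hG', hPP]
    have hcomp : HasFDerivAt (⇑P ∘ G' ∘ ⇑P) (P.comp ((fderiv ℝ G' (P w)).comp P)) w :=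
      P.hasFDerivAt.comp w (hd.hasFDerivAt.comp w P.hasFDerivAt)
    refine ⟨by rw [hGG']; exact hcomp.differentiableAt, ?_, ?_⟩
    · have h3 : G w - w = P (G' (P w) - P w) := by
        rw [map_sub, hPP]
        simp [hPP]
      rw [h3, hPn]
      exact h0
    · have hfd : fderiv ℝ G w - ContinuousLinearMap.id ℝ E4 =
          P.comp ((fderiv ℝ G' (P w) - ContinuousLinearMap.id ℝ E4).comp P) := by
        rw [hGG', hcomp.fderiv, ContinuousLinearMap.sub_comp, ContinuousLinearMap.comp_sub,
          ContinuousLinearMap.id_comp]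
        congr 1
        ext v
        simp [hPP]
      rw [hfd]
      calc ‖P.comp ((fderiv ℝ G' (P w) - ContinuousLinearMap.id ℝ E4).comp P)‖
          ≤ ‖P‖ * (‖fderiv ℝ G' (P w) - ContinuousLinearMap.id ℝ E4‖ * ‖P‖) :=
            (ContinuousLinearMap.opNorm_comp_le _ _).trans
              (mul_le_mul_of_nonneg_left (ContinuousLinearMap.opNorm_comp_le _ _)
                (norm_nonneg _))
        _ ≤ 1 * (ε * 1) := by gcongr
        _ = ε := by ring

section General

variable {E : Type*} [NormedAddCommGroup E] [NormedSpace ℝ E] [CompleteSpace E]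

/-- **A `C¹`-small perturbation of the identity is a diffeomorphism.** If `F : E → E` is `C^n`
(`n ≠ 0`, `E` a Banach space) with `‖DF(y) - I‖ ≤ 1/2` everywhere, then `F` is a `C^n`
diffeomorphism of `E`: `F - id` is `½`-Lipschitz (mean value inequality), so `F` is injective and,
by the Banach fixed point theorem applied to `y ↦ z - (F y - y)`, surjective; each `DF(y)` is
invertible (Neumann series), so `F` is a local diffeomorphism (inverse function theorem) and a
bijective local diffeomorphism is a diffeomorphism. [folklore] -/
theorem exists_diffeomorph_of_norm_fderiv_sub_id_le {F : E → E} {n : ℕ∞ω} (hn : n ≠ 0)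
    (hF : ContDiff ℝ n F)
    (hF' : ∀ y : E, ‖fderiv ℝ F y - ContinuousLinearMap.id ℝ E‖ ≤ 1 / 2) :
    ∃ Φ : Diffeomorph 𝓘(ℝ, E) 𝓘(ℝ, E) E E n, ⇑Φ = F := by
  have hdF : Differentiable ℝ F := hF.differentiable hn
  have hφd : Differentiable ℝ (fun y => F y - y) := hdF.sub differentiable_id
  have hφ' : ∀ y, fderiv ℝ (fun y => F y - y) y = fderiv ℝ F y - ContinuousLinearMap.id ℝ E :=
    fun y => ((hdF y).hasFDerivAt.sub (hasFDerivAt_id y)).fderiv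
  have hlip : LipschitzWith 2⁻¹ (fun y => F y - y) := by
    refine lipschitzWith_of_nnnorm_fderiv_le hφd fun y => ?_
    rw [← NNReal.coe_le_coe, coe_nnnorm, hφ']
    simpa using hF' y
  have hinj : Function.Injective F := by
    intro a b hab
    have h := hlip.dist_le_mul a b
    have e : dist (F a - a) (F b - b) = dist a b := by
      rw [dist_eq_norm, dist_eq_norm, hab, sub_sub_sub_cancel_left, norm_sub_rev]
    rw [e] at h
    have h0 : dist a b = 0 := by
      have := dist_nonneg (x := a) (y := b)
      norm_num at h
      linarith
    exact dist_eq_zero.1 h0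
  have hsurj : Function.Surjective F := by
    intro z
    have hc : ContractingWith 2⁻¹ (fun y => z - (F y - y)) := by
      refine ⟨by norm_num, ?_⟩
      simpa using (LipschitzWith.const z).sub hlip
    refine ⟨ContractingWith.fixedPoint _ hc, ?_⟩
    have hfix : z - (F (ContractingWith.fixedPoint _ hc) - ContractingWith.fixedPoint _ hc) =
        ContractingWith.fixedPoint _ hc := hc.fixedPoint_isFixedPt
    have h2 := congrArg (fun v => v + (F (ContractingWith.fixedPoint _ hc) -
      ContractingWith.fixedPoint _ hc)) hfix
    simp only [sub_add_cancel, add_sub_cancel] at h2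
    exact h2.symm
  have hloc : IsLocalDiffeomorph 𝓘(ℝ, E) 𝓘(ℝ, E) n F := by
    intro y
    set t : E →L[ℝ] E := ContinuousLinearMap.id ℝ E - fderiv ℝ F y with ht
    have htn : ‖t‖ < 1 := by
      rw [ht, norm_sub_rev]
      exact (hF' y).trans_lt (by norm_num)
    set u : (E →L[ℝ] E)ˣ := Units.oneSub t htn with hu
    have hu' : (u : E →L[ℝ] E) = fderiv ℝ F y := by
      rw [hu, Units.val_oneSub, ht]
      simp [ContinuousLinearMap.one_def]
    set e : E ≃L[ℝ] E := ContinuousLinearEquiv.unitsEquiv ℝ E u with he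
    have he' : (e : E →L[ℝ] E) = fderiv ℝ F y := by
      ext v
      rw [← hu']
      simp [he]
    refine Literature.Geometry.Manifold.isLocalDiffeomorphAt_of_mfderiv hn isOpen_univ
      (mem_univ y) (contMDiff_iff_contDiff.2 hF).contMDiffOn e ?_
    rw [mfderiv_eq_fderiv, he']
  exact ⟨hloc.diffeomorphOfBijective ⟨hinj, hsurj⟩, rfl⟩

end General


/-! ## A radial cut-off on `ℝ⁴` with controlled gradient -/

/-- **A smooth radial cut-off with gradient `O(1/ρ)`.** There is a constant `c ≥ 0` such that for
every `ρ > 0` some smooth `θ : ℝ⁴ → [0, 1]` vanishes on the closed ball of radius `ρ`, equals `1`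
outside the ball of radius `2ρ`, and has `‖Dθ‖ ≤ 4c/ρ` everywhere: `θ(y) = λ(‖y‖²/ρ² - 1)` with
`λ` the smooth transition function (`Real.smoothTransition`) and `c = sup |λ'|`. [folklore] -/
theorem exists_radial_cutoff : ∃ c : ℝ, 0 ≤ c ∧ ∀ ρ : ℝ, 0 < ρ → ∃ θ : E4 → ℝ,
    ContDiff ℝ ∞ θ ∧ (∀ y : E4, ‖y‖ ≤ ρ → θ y = 0) ∧ (∀ y : E4, 2 * ρ ≤ ‖y‖ → θ y = 1) ∧
      (∀ y : E4, |θ y| ≤ 1) ∧ ∀ y : E4, ‖fderiv ℝ θ y‖ ≤ 4 * c / ρ := by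
  obtain ⟨c, hc0, hc⟩ : ∃ c : ℝ, 0 ≤ c ∧ ∀ t : ℝ, 0 ≤ t → |deriv Real.smoothTransition t| ≤ c := by
    obtain ⟨c₀, hc₀⟩ := (isCompact_Icc (a := (0 : ℝ)) (b := 1)).exists_bound_of_continuousOn
      ((Real.smoothTransition.contDiff (n := 1)).continuous_deriv le_rfl).continuousOn
    refine ⟨max c₀ 0, le_max_right _ _, fun t ht => ?_⟩
    by_cases ht1 : t ≤ 1
    · have := hc₀ t ⟨ht, ht1⟩
      rw [Real.norm_eq_abs] at this
      exact this.trans (le_max_left _ _)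
    · have hev : Real.smoothTransition =ᶠ[𝓝 t] fun _ => (1 : ℝ) := by
        filter_upwards [Ioi_mem_nhds (not_le.1 ht1)] with x hx
        exact Real.smoothTransition.one_of_one_le hx.le
      rw [hev.deriv_eq]
      simp
  have hdT0 : ∀ t : ℝ, 1 < t → deriv Real.smoothTransition t = 0 := by
    intro t ht
    have hev : Real.smoothTransition =ᶠ[𝓝 t] fun _ => (1 : ℝ) := by
      filter_upwards [Ioi_mem_nhds ht] with x hx
      exact Real.smoothTransition.one_of_one_le hx.le
    rw [hev.deriv_eq]
    simp
  refine ⟨c, hc0, fun ρ₁ hρ₁0 => ?_⟩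
  set θ : E4 → ℝ := fun y => Real.smoothTransition ((ρ₁ ^ 2)⁻¹ * ‖y‖ ^ 2 - 1) with hθ
  have hθs : ContDiff ℝ ∞ θ :=
    Real.smoothTransition.contDiff.comp
      ((contDiff_const.mul (contDiff_norm_sq ℝ)).sub contDiff_const)
  have hθ0 : ∀ y : E4, ‖y‖ ≤ ρ₁ → θ y = 0 := fun y hy => by
    refine Real.smoothTransition.zero_of_nonpos ?_
    have h1 : ‖y‖ ^ 2 ≤ ρ₁ ^ 2 := pow_le_pow_left₀ (norm_nonneg _) hy 2
    rw [sub_nonpos, inv_mul_le_iff₀ (by positivity), mul_one]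
    exact h1
  have hθ1 : ∀ y : E4, 2 * ρ₁ ≤ ‖y‖ → θ y = 1 := fun y hy => by
    refine Real.smoothTransition.one_of_one_le ?_
    have h1 : (2 * ρ₁) ^ 2 ≤ ‖y‖ ^ 2 := pow_le_pow_left₀ (by positivity) hy 2
    rw [le_sub_iff_add_le, le_inv_mul_iff₀ (by positivity)]
    nlinarith [h1]
  have hθle : ∀ y : E4, |θ y| ≤ 1 := fun y =>
    abs_le.2 ⟨by linarith [Real.smoothTransition.nonneg ((ρ₁ ^ 2)⁻¹ * ‖y‖ ^ 2 - 1)],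
      Real.smoothTransition.le_one _⟩
  refine ⟨θ, hθs, hθ0, hθ1, hθle, fun y => ?_⟩
  rcases lt_or_ge ‖y‖ ρ₁ with hy | hy
  · have hev : θ =ᶠ[𝓝 y] fun _ => (0 : ℝ) := by
      filter_upwards [Metric.isOpen_ball.mem_nhds (mem_ball_zero_iff.2 hy)] with y' hy'
      exact hθ0 y' (le_of_lt (mem_ball_zero_iff.1 hy'))
    rw [hev.fderiv_eq]
    simp only [fderiv_fun_const, Pi.zero_apply, norm_zero]
    positivity
  have hτ : HasFDerivAt (fun y : E4 => (ρ₁ ^ 2)⁻¹ * ‖y‖ ^ 2 - 1)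
      ((ρ₁ ^ 2)⁻¹ • ((2 : ℝ) • innerSL ℝ y)) y := by
    have h1 : HasFDerivAt (fun y : E4 => ‖y‖ ^ 2) ((2 : ℝ) • innerSL ℝ y) y := by
      refine (hasStrictFDerivAt_norm_sq y).hasFDerivAt.congr_fderiv ?_
      rw [two_smul, two_smul]
    exact (h1.const_mul _).sub_const 1
  have hsT : HasDerivAt Real.smoothTransition
      (deriv Real.smoothTransition ((ρ₁ ^ 2)⁻¹ * ‖y‖ ^ 2 - 1))
      ((ρ₁ ^ 2)⁻¹ * ‖y‖ ^ 2 - 1) :=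
    ((Real.smoothTransition.contDiff (n := 1)).differentiable one_ne_zero _).hasDerivAt
  have hθd : HasFDerivAt θ (deriv Real.smoothTransition ((ρ₁ ^ 2)⁻¹ * ‖y‖ ^ 2 - 1) •
      ((ρ₁ ^ 2)⁻¹ • ((2 : ℝ) • innerSL ℝ y))) y := by
    have h := hsT.comp_hasFDerivAt y hτ
    exact h
  rw [hθd.fderiv, norm_smul, norm_smul, norm_smul, innerSL_apply_norm, Real.norm_eq_abs,
    Real.norm_eq_abs, Real.norm_eq_abs, abs_of_pos (by positivity : (0 : ℝ) < (ρ₁ ^ 2)⁻¹),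
    abs_two]
  rcases le_or_gt ((ρ₁ ^ 2)⁻¹ * ‖y‖ ^ 2 - 1) 1 with hle | hlt
  · have hy2 : ‖y‖ ≤ 2 * ρ₁ := by
      have h1 : (ρ₁ ^ 2)⁻¹ * ‖y‖ ^ 2 ≤ 2 := by linarith
      rw [inv_mul_le_iff₀ (by positivity)] at h1
      nlinarith [norm_nonneg y, hρ₁0]
    have hτ0 : 0 ≤ (ρ₁ ^ 2)⁻¹ * ‖y‖ ^ 2 - 1 := by
      rw [sub_nonneg, le_inv_mul_iff₀ (by positivity), mul_one]
      exact pow_le_pow_left₀ hρ₁0.le hy 2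
    calc |deriv Real.smoothTransition ((ρ₁ ^ 2)⁻¹ * ‖y‖ ^ 2 - 1)| * ((ρ₁ ^ 2)⁻¹ * (2 * ‖y‖))
        ≤ c * ((ρ₁ ^ 2)⁻¹ * (2 * (2 * ρ₁))) := by
          gcongr
          exact hc _ hτ0
      _ = 4 * c / ρ₁ := by
          field_simp
          ring
  · rw [hdT0 _ hlt, abs_zero, zero_mul]
    positivity

end FlatCutoff

/-- **Registered helper sub-goal `helper_flatCutoffPerturbId`** (third auxiliary file of stub
`stub_flatCutoff`): a smooth `C¹`-small perturbation of the identity of `ℝ⁴` is a diffeomorphism,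
the `ℝ⁴` case of `FlatCutoff.exists_diffeomorph_of_norm_fderiv_sub_id_le`. [folklore] -/
theorem helper_flatCutoffPerturbId :
    ∀ (F : EuclideanSpace ℝ (Fin 4) → EuclideanSpace ℝ (Fin 4)), ContDiff ℝ ∞ F →
      (∀ y : EuclideanSpace ℝ (Fin 4),
        ‖fderiv ℝ F y - ContinuousLinearMap.id ℝ (EuclideanSpace ℝ (Fin 4))‖ ≤ 1 / 2) →
      ∃ Φ : EuclideanSpace ℝ (Fin 4) ≃ₘ⟮𝓡 4, 𝓡 4⟯ EuclideanSpace ℝ (Fin 4), ⇑Φ = F :=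
  fun _ hF hF' => FlatCutoff.exists_diffeomorph_of_norm_fderiv_sub_id_le (by simp) hF hF'

end Summit.SmoothPoincare4.SmoothPoincare4.Theorems.GromovRecognitionRelEnd.CrossCapLaurent

end
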